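import Summits.PneNP.PneNP.Theses.KarlinRubin
import Summits.PneNP.PneNP.Theorems.KarlinRubinMonotoneSufficesTransportMixtureBound
import Summits.PneNP.PneNP.Theorems.KarlinRubinMonotoneSufficesTransportBridge
import Summits.PneNP.PneNP.Theorems.KarlinRubinMonotoneSufficesTransportAsymptotics

/-!
# Crux `MonotoneSuffices` (stmt-PneNP-18026), line `slice-transport` — the stub `stub_transport`

**Slice transport by ranked deletion** (registered stub of
`Summits/PneNP/PneNP/Cruxes/MonotoneSuffices/Lines/slice_transport.lean`). For `0 < δ < 1/2` there is
`c₁` (here `9`) such that every `B₂`-family `C` whose unconditional error sum (type I under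
`G(n,1/2)` + type II under the planted `⌈n^{1/2-δ}⌉`-clique) tends to `0` yields a `B₂`-family `C₁`,
`|C₁ n| ≤ |C n| + n^9`, whose SLICE error sum at `m⋆(n) = ⌊C(n,2)/2⌋ + n(⌊log₂ n⌋+1)` tends to `0`.

Construction and proof (parts 1–10, files `KarlinRubinMonotoneSufficesTransport*.lean`):
`C₁ n = C n ∘ del σ d`, where `del σ d` switches off the `d` lowest-ranked present edges for a ranking
`σ` of the edge slots (a `B₂`-gadget of size `c N⁴ ≤ n⁹`, part 4). Averaged over ALL rankings, the
deletion maps the uniform slice-`m⋆` law EXACTLY onto the uniform slice-`(m⋆-d)` law, and the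
planted slice-`m⋆` law onto the planted slice-`(m⋆-d)` law off an event of probability `≤ κd/m⋆`
(parts 1, 2, 6); mixing `d` with the weights `C(N, m⋆-d)/2^N` collapses the null part onto
`Pr_{G(n,1/2)}[C n = 1]` and the planted part onto `Pr_{planted}[C n = 0]` up to the `ℓ₁`-distance
`κ/√(N-κ+1)` of the two slice profiles and tails `2Δκ/m⋆ + N/(2Δ²)` (parts 3, 7, 8); so SOME
`(σ, d)` (Adleman) has slice error sum `≤ 2·(…) → 0` (parts 9, 10 do the bookkeeping in `n`).
-/

set_option linter.dupNamespace false -- `Summit.PneNP.PneNP.…`: summit = sub-problem name (D-0017 single-conjunct layout)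

namespace Summit.PneNP.PneNP.Theorems.MonotoneSuffices.SliceTransport

open Literature.Computability.Complexity Literature.Probability.RandomGraphs.PlantedClique Filter Finset

open scoped Classical

/-- One term of an `ℝ≥0∞` sum tending to `0` tends to `0`, in `ℝ`. [folklore] -/
theorem tendsto_toReal_of_add_tendsto_zero {a b : ℕ → ENNReal} (h : Tendsto (fun n => a n + b n) atTop (nhds 0)) :
    Tendsto (fun n => (a n).toReal) atTop (nhds 0) ∧ Tendsto (fun n => (b n).toReal) atTop (nhds 0) := by
  have ha : Tendsto a atTop (nhds 0) :=
    tendsto_of_tendsto_of_tendsto_of_le_of_le tendsto_const_nhds h (fun _ => bot_le) fun n => le_self_add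
  have hb : Tendsto b atTop (nhds 0) :=
    tendsto_of_tendsto_of_tendsto_of_le_of_le tendsto_const_nhds h (fun _ => bot_le) fun n => le_add_self
  refine ⟨?_, ?_⟩
  · have := (ENNReal.tendsto_toReal ENNReal.zero_ne_top).comp ha
    rw [ENNReal.toReal_zero] at this
    exact this
  · have := (ENNReal.tendsto_toReal ENNReal.zero_ne_top).comp hb
    rw [ENNReal.toReal_zero] at this
    exact this

/-- **The per-`n` step.** For a circuit `Cn` over `B₂` on the edge slots of `Kₙ`, under the size
conditions of part 10 and above the gadget threshold, some `B₂`-circuit `C₁` with `|C₁| ≤ |Cn| + n⁹`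
has slice error sum at `m⋆` at most
`2·(Pr₀[Cn = 1] + Pr₁[Cn = 0] + κ/√(N-κ+1) + 2Δκ/m⋆ + N/(2Δ²))`. [folklore] -/
theorem transport_step {δ : ℝ} {cg N₀ : ℕ}
    (hgad : ∀ (ι : Type) [Fintype ι] [DecidableEq ι], N₀ ≤ Fintype.card ι → ∀ C : Circuit ι, C.IsOver B2 →
      ∀ (σ : ι ≃ Fin (Fintype.card ι)) (d : ℕ), ∃ C₁ : Circuit ι, C₁.IsOver B2 ∧
        C₁.size ≤ C.size + cg * Fintype.card ι ^ 4 ∧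
        ∀ x, C₁.eval x = C.eval (fun a => x a && decide (d ≤ #(univ.filter fun b => x b = true ∧ σ b < σ a))))
    {n : ℕ} (Cn : Circuit ((⊤ : SimpleGraph (Fin n)).edgeSet)) (hCn : Cn.IsOver B2)
    (hN₀ : N₀ ≤ n.choose 2)
    (hκm : (min ⌈(n : ℝ) ^ (1 / 2 - δ)⌉₊ n).choose 2 ≤ n.choose 2 / 2 + n * (Nat.log 2 n + 1))
    (hmN : n.choose 2 / 2 + n * (Nat.log 2 n + 1) ≤ n.choose 2)
    (hm1 : 1 ≤ n.choose 2 / 2 + n * (Nat.log 2 n + 1))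
    (hΔ : 0 < n * (Nat.log 2 n + 1))
    (h2Δ : 2 * (n * (Nat.log 2 n + 1)) ≤ n.choose 2 / 2 + n * (Nat.log 2 n + 1))
    (hΔN : 2 * n.choose 2 ≤ (n * (Nat.log 2 n + 1) + 1) ^ 2)
    (hc : cg * (n.choose 2) ^ 4 ≤ n ^ 9) :
    ∃ C₁ : Circuit ((⊤ : SimpleGraph (Fin n)).edgeSet), C₁.IsOver B2 ∧ C₁.size ≤ Cn.size + n ^ 9 ∧
      ((univ.filter fun x : EdgeVec n =>
            (univ.filter fun e => x e = true).card = n.choose 2 / 2 + n * (Nat.log 2 n + 1) ∧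
              C₁.eval x = true).card : ℝ) /
          ((univ.filter fun x : EdgeVec n =>
            (univ.filter fun e => x e = true).card = n.choose 2 / 2 + n * (Nat.log 2 n + 1)).card : ℝ) +
        (((kSubsets n ⌈(n : ℝ) ^ (1 / 2 - δ)⌉₊ ×ˢ (univ : Finset (EdgeVec n))).filter fun p =>
            plant p.1 p.2 = p.2 ∧
              (univ.filter fun e => p.2 e = true).card = n.choose 2 / 2 + n * (Nat.log 2 n + 1) ∧
                C₁.eval p.2 = false).card : ℝ) /
          (((kSubsets n ⌈(n : ℝ) ^ (1 / 2 - δ)⌉₊ ×ˢ (univ : Finset (EdgeVec n))).filter fun p =>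
            plant p.1 p.2 = p.2 ∧
              (univ.filter fun e => p.2 e = true).card = n.choose 2 / 2 + n * (Nat.log 2 n + 1)).card : ℝ) ≤
      2 * (((erdosRenyiHalf n).toOuterMeasure {x | Cn.eval x = true}).toReal +
        (((plantedCliqueDist n ⌈(n : ℝ) ^ (1 / 2 - δ)⌉₊).toOuterMeasure {x | Cn.eval x = false}).toReal +
          (((min ⌈(n : ℝ) ^ (1 / 2 - δ)⌉₊ n).choose 2 : ℕ) : ℝ) /
            Real.sqrt (((n.choose 2 - (min ⌈(n : ℝ) ^ (1 / 2 - δ)⌉₊ n).choose 2 : ℕ) : ℝ) + 1)) +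
        2 * ((n * (Nat.log 2 n + 1) : ℕ) : ℝ) * (((min ⌈(n : ℝ) ^ (1 / 2 - δ)⌉₊ n).choose 2 : ℕ) : ℝ) /
          ((n.choose 2 / 2 + n * (Nat.log 2 n + 1) : ℕ) : ℝ) +
        ((n.choose 2 : ℕ) : ℝ) / 2 / ((n * (Nat.log 2 n + 1) : ℕ) : ℝ) ^ 2) := by
  set k := ⌈(n : ℝ) ^ (1 / 2 - δ)⌉₊ with hk
  set κ := (min k n).choose 2 with hκdef
  set m := n.choose 2 / 2 + n * (Nat.log 2 n + 1) with hmdef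
  set Δ := n * (Nat.log 2 n + 1) with hΔdef
  have hcard : Fintype.card ((⊤ : SimpleGraph (Fin n)).edgeSet) = n.choose 2 := card_edgeSet_top_fin n
  -- the good ranking
  have hκ : ∀ A ∈ kSubsets n k, #(univ.filter fun e : (⊤ : SimpleGraph (Fin n)).edgeSet =>
      ∀ v ∈ (e : Sym2 (Fin n)), v ∈ A) = κ := fun A hA => by
    rw [card_cliqueSlots A, card_of_mem_kSubsets hA]
  obtain ⟨σ, d, hdm, hbound⟩ := exists_good_ranking (α := (⊤ : SimpleGraph (Fin n)).edgeSet)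
    Cn.eval (kSubsets n k) (kSubsets_nonempty n k)
    (fun A => univ.filter fun e : (⊤ : SimpleGraph (Fin n)).edgeSet => ∀ v ∈ (e : Sym2 (Fin n)), v ∈ A)
    (κ := κ) (m := m) (Δ := Δ) hκ hκm (by rw [hcard]; exact hmN) hm1 (by rw [hcard]) hΔ h2Δ (by rw [hcard]; exact hΔN)
  -- the circuit
  obtain ⟨C₁, hC₁B, hC₁s, hC₁e⟩ := hgad _ (by rw [hcard]; exact hN₀) Cn hCn σ d
  refine ⟨C₁, hC₁B, ?_, ?_⟩
  · rw [hcard] at hC₁s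
    exact hC₁s.trans (Nat.add_le_add_left hc _)
  · -- rewrite the slice errors of `C₁` as those of `Cn ∘ del σ d`, in the vocabulary of part 8
    have e1 : ((univ.filter fun x : EdgeVec n =>
        (univ.filter fun e => x e = true).card = m ∧ C₁.eval x = true).card : ℝ) =
        #((univ : Finset (EdgeVec n)).filter fun x => #(univ.filter fun a => x a = true) = m ∧
          Cn.eval (fun a => x a && decide (d ≤ #(univ.filter fun b => x b = true ∧ σ b < σ a))) = true) := by
      exact congrArg (fun t : Finset (EdgeVec n) => (#t : ℝ)) (filter_congr fun x _ => by rw [hC₁e x])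
    have e2 : (((kSubsets n k ×ˢ (univ : Finset (EdgeVec n))).filter fun p =>
        plant p.1 p.2 = p.2 ∧ (univ.filter fun e => p.2 e = true).card = m ∧ C₁.eval p.2 = false).card : ℝ) =
        #((kSubsets n k ×ˢ (univ : Finset (EdgeVec n))).filter fun p =>
          (univ.filter fun e : (⊤ : SimpleGraph (Fin n)).edgeSet => ∀ v ∈ (e : Sym2 (Fin n)), v ∈ p.1) ⊆
            (univ.filter fun a => p.2 a = true) ∧ #(univ.filter fun a => p.2 a = true) = m ∧
          Cn.eval (fun a => p.2 a && decide (d ≤ #(univ.filter fun b => p.2 b = true ∧ σ b < σ a))) = false) := by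
      exact congrArg (fun t : Finset (Finset (Fin n) × EdgeVec n) => (#t : ℝ))
        (filter_congr fun p _ => by rw [plant_eq_self_iff, hC₁e p.2])
    have e3 : (((kSubsets n k ×ˢ (univ : Finset (EdgeVec n))).filter fun p =>
        plant p.1 p.2 = p.2 ∧ (univ.filter fun e => p.2 e = true).card = m).card : ℝ) =
        #((kSubsets n k ×ˢ (univ : Finset (EdgeVec n))).filter fun p =>
          (univ.filter fun e : (⊤ : SimpleGraph (Fin n)).edgeSet => ∀ v ∈ (e : Sym2 (Fin n)), v ∈ p.1) ⊆
            (univ.filter fun a => p.2 a = true) ∧ #(univ.filter fun a => p.2 a = true) = m) := by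
      exact congrArg (fun t : Finset (Finset (Fin n) × EdgeVec n) => (#t : ℝ))
        (filter_congr fun p _ => by rw [plant_eq_self_iff])
    rw [e1, e2, e3]
    refine hbound.trans (le_of_eq ?_)
    -- identify the bracket
    rw [toReal_erdosRenyiHalf_eq, toReal_plantedCliqueDist_eq, hcard]

/-- **stub_transport** (registered stub of line `slice-transport`, crux stmt-PneNP-18026): slice
transport by ranked deletion, `c₁ = 9`. For `0 < δ < 1/2`, every `B₂`-family with unconditional error
sum `→ 0` at clique size `⌈n^{1/2-δ}⌉` yields a `B₂`-family `C₁`, `|C₁ n| ≤ |C n| + n^9`, whose slice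
error sum at `m⋆(n) = ⌊C(n,2)/2⌋ + n(⌊log₂ n⌋+1)` tends to `0` (per-`n` step `transport_step`, chosen
nonuniformly in `n`; squeeze with the vanishing bound of parts 9–10). [folklore] -/
theorem stub_transport :
    ∀ δ : ℝ, 0 < δ → δ < 1 / 2 → ∃ c₁ : ℕ, ∀ C : (n : ℕ) → Circuit ((⊤ : SimpleGraph (Fin n)).edgeSet), (∀ᶠ n : ℕ in atTop, (C n).IsOver B2) → Tendsto (fun n : ℕ => (erdosRenyiHalf n).toOuterMeasure {x | (C n).eval x = true} + (plantedCliqueDist n ⌈(n : ℝ) ^ (1 / 2 - δ)⌉₊).toOuterMeasure {x | (C n).eval x = false}) atTop (nhds 0) → ∃ C₁ : (n : ℕ) → Circuit ((⊤ : SimpleGraph (Fin n)).edgeSet), (∀ᶠ n : ℕ in atTop, (C₁ n).IsOver B2 ∧ (C₁ n).size ≤ (C n).size + n ^ c₁) ∧ Tendsto (fun n : ℕ => ((univ.filter fun x : EdgeVec n => (univ.filter fun e => x e = true).card = n.choose 2 / 2 + n * (Nat.log 2 n + 1) ∧ (C₁ n).eval x = true).card : ℝ) / ((univ.filter fun x :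 EdgeVec n => (univ.filter fun e => x e = true).card = n.choose 2 / 2 + n * (Nat.log 2 n + 1)).card : ℝ) + (((kSubsets n ⌈(n : ℝ) ^ (1 / 2 - δ)⌉₊ ×ˢ (univ : Finset (EdgeVec n))).filter fun p => plant p.1 p.2 = p.2 ∧ (univ.filter fun e => p.2 e = true).card = n.choose 2 / 2 + n * (Nat.log 2 n + 1) ∧ (C₁ n).eval p.2 = false).card : ℝ) / (((kSubsets n ⌈(n : ℝ) ^ (1 / 2 - δ)⌉₊ ×ˢ (univ : Finset (EdgeVec n))).filter fun p => plant p.1 p.2 = p.2 ∧ (univ.filter fun e => p.2 e = true).card = n.choose 2 / 2 + n * (Nat.log 2 n + 1)).card : ℝ)) atTop (nhds 0) := by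
  intro δ hδ hδ'
  obtain ⟨cg, N₀, hgad0⟩ := exists_del_circuit
  have hgad : ∀ (ι : Type) [Fintype ι] [DecidableEq ι], N₀ ≤ Fintype.card ι → ∀ C : Circuit ι, C.IsOver B2 →
      ∀ (σ : ι ≃ Fin (Fintype.card ι)) (d : ℕ), ∃ C₁ : Circuit ι, C₁.IsOver B2 ∧
        C₁.size ≤ C.size + cg * Fintype.card ι ^ 4 ∧
        ∀ x, C₁.eval x = C.eval (fun a => x a && decide (d ≤ #(univ.filter fun b => x b = true ∧ σ b < σ a))) :=
    fun ι _ _ => hgad0 ι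
  refine ⟨9, fun C hCB2 hT => ?_⟩
  obtain ⟨hPI, hPII⟩ := tendsto_toReal_of_add_tendsto_zero hT
  -- the good `n`: the family is over `B₂` there and all size conditions hold
  have hgood : ∀ᶠ n : ℕ in atTop, (C n).IsOver B2 ∧ (N₀ ≤ n.choose 2 ∧ (min ⌈(n : ℝ) ^ (1 / 2 - δ)⌉₊ n).choose 2 ≤ n.choose 2 / 2 + n * (Nat.log 2 n + 1) ∧ n.choose 2 / 2 + n * (Nat.log 2 n + 1) ≤ n.choose 2 ∧ 1 ≤ n.choose 2 / 2 + n * (Nat.log 2 n + 1) ∧ 0 < n * (Nat.log 2 n + 1) ∧ 2 * (n * (Nat.log 2 n + 1)) ≤ n.choose 2 / 2 + n * (Nat.log 2 n + 1) ∧ 2 * n.choose 2 ≤ (n * (Nat.log 2 n + 1) + 1) ^ 2 ∧ cg * (n.choose 2) ^ 4 ≤ n ^ 9) :=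
    hCB2.and (eventually_transport_params hδ cg N₀)
  -- the transported family (junk: `C n` itself) off the good `n`
  let C₁ : (n : ℕ) → Circuit ((⊤ : SimpleGraph (Fin n)).edgeSet) := fun n =>
    if h : (C n).IsOver B2 ∧ (N₀ ≤ n.choose 2 ∧ (min ⌈(n : ℝ) ^ (1 / 2 - δ)⌉₊ n).choose 2 ≤ n.choose 2 / 2 + n * (Nat.log 2 n + 1) ∧ n.choose 2 / 2 + n * (Nat.log 2 n + 1) ≤ n.choose 2 ∧ 1 ≤ n.choose 2 / 2 + n * (Nat.log 2 n + 1) ∧ 0 < n * (Nat.log 2 n + 1) ∧ 2 * (n * (Nat.log 2 n + 1)) ≤ n.choose 2 / 2 + n * (Nat.log 2 n + 1) ∧ 2 * n.choose 2 ≤ (n * (Nat.log 2 n + 1) + 1) ^ 2 ∧ cg * (n.choose 2) ^ 4 ≤ n ^ 9) then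
      (transport_step (δ := δ) hgad (C n) h.1 h.2.1 h.2.2.1 h.2.2.2.1 h.2.2.2.2.1 h.2.2.2.2.2.1 h.2.2.2.2.2.2.1
        h.2.2.2.2.2.2.2.1 h.2.2.2.2.2.2.2.2).choose
    else C n
  refine ⟨C₁, ?_, ?_⟩
  · filter_upwards [hgood] with n h
    have hspec := (transport_step (δ := δ) hgad (C n) h.1 h.2.1 h.2.2.1 h.2.2.2.1 h.2.2.2.2.1 h.2.2.2.2.2.1
      h.2.2.2.2.2.2.1 h.2.2.2.2.2.2.2.1 h.2.2.2.2.2.2.2.2).choose_spec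
    simp only [C₁, dif_pos h]
    exact ⟨hspec.1, hspec.2.1⟩
  · -- squeeze between `0` and the vanishing bound
    have hη : Tendsto (fun n : ℕ => 2 * (((erdosRenyiHalf n).toOuterMeasure {x | (C n).eval x = true}).toReal +
        (((plantedCliqueDist n ⌈(n : ℝ) ^ (1 / 2 - δ)⌉₊).toOuterMeasure {x | (C n).eval x = false}).toReal +
          (((min ⌈(n : ℝ) ^ (1 / 2 - δ)⌉₊ n).choose 2 : ℕ) : ℝ) /
            Real.sqrt (((n.choose 2 - (min ⌈(n : ℝ) ^ (1 / 2 - δ)⌉₊ n).choose 2 : ℕ) : ℝ) + 1)) +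
        2 * ((n * (Nat.log 2 n + 1) : ℕ) : ℝ) * (((min ⌈(n : ℝ) ^ (1 / 2 - δ)⌉₊ n).choose 2 : ℕ) : ℝ) /
          ((n.choose 2 / 2 + n * (Nat.log 2 n + 1) : ℕ) : ℝ) +
        ((n.choose 2 : ℕ) : ℝ) / 2 / ((n * (Nat.log 2 n + 1) : ℕ) : ℝ) ^ 2)) atTop (nhds 0) := by
      have h := ((hPI.add ((hPII.add (tendsto_kappa_div_sqrt hδ hδ')).add (tendsto_delta_kappa_div hδ hδ'))).add
        tendsto_choose_div_delta_sq).const_mul 2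
      simp only [add_zero, mul_zero] at h
      refine h.congr' (Eventually.of_forall fun n => ?_)
      ring
    refine tendsto_of_tendsto_of_tendsto_of_le_of_le' tendsto_const_nhds hη
      (Eventually.of_forall fun n => by positivity) ?_
    filter_upwards [hgood] with n h
    have hspec := (transport_step (δ := δ) hgad (C n) h.1 h.2.1 h.2.2.1 h.2.2.2.1 h.2.2.2.2.1 h.2.2.2.2.2.1
      h.2.2.2.2.2.2.1 h.2.2.2.2.2.2.2.1 h.2.2.2.2.2.2.2.2).choose_spec
    simp only [C₁, dif_pos h]
    exact hspec.2.2

end Summit.PneNP.PneNP.Theorems.MonotoneSuffices.SliceTransport
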